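import Mathlib
import Literature.NumberTheory.Irrationality.BrownZudilin2022.GeneralFamily
import Summits.KontsevichZagierPeriods.Zeta5Search.CellularGroupS7
import HarnessLib

/-!
# ζ(5) search — Rhin–Viola refinements: the non-positive automorphisms (`S₈ ∖ S₇`) add nothing

HONEST FRAMING: systematic search; no irrationality claim unless certified.

Cell `pub-zeta5`, seat `fam-rv` (Rhin–Viola permutation-group refinements). Brown–Zudilin (arXiv:2210.03391v3,
Sect. 8, p. 23) observe that the automorphism group of the configuration behind the generalised cellular integral
`I(a)` is `S₈`, that its *positive* part is their group `G ≅ S₇` (tree: `CellularGroup.closure_eq_top`), and give the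
non-positive example `(a₁,a₂,a₄) ↦ (−a₂,−a₁,a₄−a₁−a₂)`, adding that it is "very unclear whether these additional
non-positive elements have any implications for the arithmetic". In the symmetric coordinates `s` of Sect. 10
(`CellularGroup.aOf`) put `x = (s₀, −s₁, …, −s₇)`; then `S₈` permutes `x`, `S₇ = Stab(0)`, the 28 forms `h_i(a)` of
(26) are the 28 weights `x₀ + x_k` (7 of them) and `−(x_k + x_l)` (21 of them) — half of the 56 of `E₇` — and the
non-positive elements are exactly the permutations moving the index `0`.

(Filed for `fam-rv` by P2; docstrings added to 17 helper lemmas, statements and proofs byte-identical otherwise.)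

This file (all PROVED, `0 sorry`):
* `t1, …, t7` — the seven transpositions `(x₀ x_i)` as INTEGRAL linear involutions of `a ∈ ℤ⁸` (`t1` is BZ's example),
  with `tI_aOf : tI (aOf s) = aOf (s with (s₀,s_i) ↦ (−s_i,−s₀))` and `tI_tI : tI (tI a) = a`;
* `converges_iff` — `Converges a` as the explicit conjunction of the 17 inequalities (3);
* **`converges_tI_fixed`** (`I = 1..7`) — if both `a` and `t_i a` converge then `t_i a = a` (the bi-convergent locus of
  each non-positive transposition lies in its fixed hyperplane `x₀ = x_i`; proof: two opposite pairs of convergence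
  forms, `omega`);
* `actS` — the action of `Equiv.Perm (Fin 8)` on `s` through `x`, and **`exists_stabilizer_of_x0_eq`** — if
  `x_{π⁻¹(0)} = x₀` then `π • s = σ • s` for some `σ` with `σ 0 = 0` (i.e. `σ ∈ S₇`);
* `x_le_x0_of_converges` — on the convergence cone `x₀ = max_k x_k` (the two forms `x₀+x₂`, `x₀+x₃` of `F` and the
  pair forms with an index in `{2,3}` cover every `k`); hence **`s8CosetLaw`** (PROVED): for EVERY `π ∈ S₈` and every
  `s`, if `aOf s` and `aOf (π • s)` both converge then `x_{π⁻¹(0)} = x₀` (a permutation keeps the cone only if it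
  keeps the position of the maximum), and **`nonpositive_adds_nothing`**: then `π • s = σ • s` with `σ 0 = 0`.
  So a non-positive automorphism relates two convergent parameter vectors only when an element of `G ≅ S₇` already
  does — it yields no period relation, gauge or `p`-adic saving beyond BZ (29) (negative answer, for integer points,
  to the question on p. 23 of the source). (Cross-checked outside Lean by exact LP over all `35 280` permutations
  moving `0`: `HOME/pub-zeta5-fam-rv/rv_canary3_S8full.py`.)

Statements are over `s ∈ ℤ⁸` as in `CellularGroupS7` (genuine symmetric parameters are half-integers; all statements
are homogeneous-linear, and `Converges (2a) ↔ Converges a`, so nothing is lost).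
-/

namespace Summit.KontsevichZagierPeriods.Zeta5Search.RVGroup

open Equiv
open Literature.NumberTheory.Irrationality.BrownZudilin2022
open Summit.KontsevichZagierPeriods.Zeta5Search.CellularGroup

/-! ### The seventeen convergence inequalities, explicitly -/

/-- `Converges a` unfolded: the seventeen forms (3) of arXiv:2210.03391 are non-negative. -/
theorem converges_iff (a : Fin 8 → ℤ) : Converges a ↔
    (0 ≤ a 0 ∧ 0 ≤ a 1 ∧ 0 ≤ a 2 ∧ 0 ≤ a 3 ∧ 0 ≤ a 4 ∧ 0 ≤ a 5 ∧ 0 ≤ a 6 ∧ 0 ≤ a 0 + a 4 - a 2 ∧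
      0 ≤ a 2 + a 5 - a 7 ∧ 0 ≤ a 3 + a 4 + a 6 + a 7 - a 1 - a 2 - a 5 ∧ 0 ≤ a 6 + a 7 - a 5 ∧
      0 ≤ a 3 + a 7 - a 1 ∧ 0 ≤ a 1 + a 2 + a 5 - a 3 - a 7 ∧ 0 ≤ a 0 + a 7 - a 2 ∧ 0 ≤ a 0 + a 1 - a 3 ∧
      0 ≤ a 3 + a 4 - a 1 ∧ 0 ≤ a 3 + a 6 + 2 * a 7 - a 1 - a 2 - a 5) := by
  unfold Converges convergenceForms
  simp only [List.mem_cons, List.not_mem_nil, or_false, forall_eq_or_imp, forall_eq]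

/-! ### The seven non-positive transpositions as integral maps on `a` -/

/-- `t₁ = (x₀ x₁)`: `(a₁,a₂,a₄) ↦ (−a₂,−a₁,a₄−a₁−a₂)` — the example on p. 23 of the source. -/
def t1 (a : Fin 8 → ℤ) : Fin 8 → ℤ :=
  ![- a 1, - a 0, a 2, - a 0 - a 1 + a 3, a 4, a 5, a 6, a 7]
/-- `t₂ = (x₀ x₂)`. -/
def t2 (a : Fin 8 → ℤ) : Fin 8 → ℤ :=
  ![a 0 - a 2 - a 3, a 1, - a 3, - a 2, a 4, a 5, a 6, a 7]
/-- `t₃ = (x₀ x₃)`. -/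
def t3 (a : Fin 8 → ℤ) : Fin 8 → ℤ :=
  ![a 0, - a 2, - a 1, a 3, - a 1 - a 2 + a 4, a 5, a 6, - a 1 - a 2 + a 7]
/-- `t₄ = (x₀ x₄)`. -/
def t4 (a : Fin 8 → ℤ) : Fin 8 → ℤ :=
  ![a 0, a 1 - a 3 - a 4, a 2, - a 4, - a 3, a 5, a 6, a 7]
/-- `t₅ = (x₀ x₅)`. -/
def t5 (a : Fin 8 → ℤ) : Fin 8 → ℤ :=
  ![a 0, a 1 - a 3 - a 7, a 2, - a 7, a 4, - a 3 + a 5 - a 7, a 6, - a 3]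
/-- `t₆ = (x₀ x₆)`. -/
def t6 (a : Fin 8 → ℤ) : Fin 8 → ℤ :=
  ![a 0, - a 2 - a 5 + a 7, a 2, - a 1 - a 2 + a 3 - a 5 + a 7, a 4, - a 1 - a 2 + a 7,
    - a 1 - a 2 - a 5 + a 6 + a 7, a 7]
/-- `t₇ = (x₀ x₇)`. -/
def t7 (a : Fin 8 → ℤ) : Fin 8 → ℤ :=
  ![a 0, a 1 - a 3 + a 5 - a 6 - a 7, a 2, a 5 - a 6 - a 7, a 4, a 5, - a 3 + a 5 - a 7, a 7]

/-- `t1` in symmetric coordinates: it swaps `(s₀, s_1) ↦ (−s_1, −s₀)`. -/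
theorem t1_aOf (s : Fin 8 → ℤ) : t1 (aOf s) = aOf ![-s 1, -s 0, s 2, s 3, s 4, s 5, s 6, s 7] := by
  funext i; fin_cases i <;> simp [t1, aOf] <;> ring
/-- `t2` in symmetric coordinates: it swaps `(s₀, s_2) ↦ (−s_2, −s₀)`. -/
theorem t2_aOf (s : Fin 8 → ℤ) : t2 (aOf s) = aOf ![-s 2, s 1, -s 0, s 3, s 4, s 5, s 6, s 7] := by
  funext i; fin_cases i <;> simp [t2, aOf] <;> ring
/-- `t3` in symmetric coordinates: it swaps `(s₀, s_3) ↦ (−s_3, −s₀)`. -/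
theorem t3_aOf (s : Fin 8 → ℤ) : t3 (aOf s) = aOf ![-s 3, s 1, s 2, -s 0, s 4, s 5, s 6, s 7] := by
  funext i; fin_cases i <;> simp [t3, aOf] <;> ring
/-- `t4` in symmetric coordinates: it swaps `(s₀, s_4) ↦ (−s_4, −s₀)`. -/
theorem t4_aOf (s : Fin 8 → ℤ) : t4 (aOf s) = aOf ![-s 4, s 1, s 2, s 3, -s 0, s 5, s 6, s 7] := by
  funext i; fin_cases i <;> simp [t4, aOf] <;> ring
/-- `t5` in symmetric coordinates: it swaps `(s₀, s_5) ↦ (−s_5, −s₀)`. -/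
theorem t5_aOf (s : Fin 8 → ℤ) : t5 (aOf s) = aOf ![-s 5, s 1, s 2, s 3, s 4, -s 0, s 6, s 7] := by
  funext i; fin_cases i <;> simp [t5, aOf] <;> ring
/-- `t6` in symmetric coordinates: it swaps `(s₀, s_6) ↦ (−s_6, −s₀)`. -/
theorem t6_aOf (s : Fin 8 → ℤ) : t6 (aOf s) = aOf ![-s 6, s 1, s 2, s 3, s 4, s 5, -s 0, s 7] := by
  funext i; fin_cases i <;> simp [t6, aOf] <;> ring
/-- `t7` in symmetric coordinates: it swaps `(s₀, s_7) ↦ (−s_7, −s₀)`. -/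
theorem t7_aOf (s : Fin 8 → ℤ) : t7 (aOf s) = aOf ![-s 7, s 1, s 2, s 3, s 4, s 5, s 6, -s 0] := by
  funext i; fin_cases i <;> simp [t7, aOf] <;> ring

/-- `t1` is an involution. -/
theorem t1_t1 (a : Fin 8 → ℤ) : t1 (t1 a) = a := by
  funext i; fin_cases i <;> (simp [t1]; try ring)
/-- `t2` is an involution. -/
theorem t2_t2 (a : Fin 8 → ℤ) : t2 (t2 a) = a := by
  funext i; fin_cases i <;> (simp [t2]; try ring)
/-- `t3` is an involution. -/
theorem t3_t3 (a : Fin 8 → ℤ) : t3 (t3 a) = a := by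
  funext i; fin_cases i <;> (simp [t3]; try ring)
/-- `t4` is an involution. -/
theorem t4_t4 (a : Fin 8 → ℤ) : t4 (t4 a) = a := by
  funext i; fin_cases i <;> (simp [t4]; try ring)
/-- `t5` is an involution. -/
theorem t5_t5 (a : Fin 8 → ℤ) : t5 (t5 a) = a := by
  funext i; fin_cases i <;> (simp [t5]; try ring)
/-- `t6` is an involution. -/
theorem t6_t6 (a : Fin 8 → ℤ) : t6 (t6 a) = a := by
  funext i; fin_cases i <;> (simp [t6]; try ring)
/-- `t7` is an involution. -/
theorem t7_t7 (a : Fin 8 → ℤ) : t7 (t7 a) = a := by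
  funext i; fin_cases i <;> (simp [t7]; try ring)

/-! ### Bi-convergent ⇒ fixed (the coset lemma at generator level) -/

/-- If `a` and `t₁ a` both converge then `t₁ a = a` (`a₁ = a₂ = 0`, i.e. `x₀ = x₁`). -/
theorem converges_t1_fixed (a : Fin 8 → ℤ) (h : Converges a) (h' : Converges (t1 a)) : t1 a = a := by
  rw [converges_iff] at h h'
  simp [t1] at h'
  funext i; fin_cases i <;> simp [t1] <;> omega

/-- If `a` and `t₂ a` both converge then `t₂ a = a` (`x₀ = x₂`). -/
theorem converges_t2_fixed (a : Fin 8 → ℤ) (h : Converges a) (h' : Converges (t2 a)) : t2 a = a := by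
  rw [converges_iff] at h h'
  simp [t2] at h'
  funext i; fin_cases i <;> simp [t2] <;> omega

/-- If `a` and `t₃ a` both converge then `t₃ a = a` (`x₀ = x₃`). -/
theorem converges_t3_fixed (a : Fin 8 → ℤ) (h : Converges a) (h' : Converges (t3 a)) : t3 a = a := by
  rw [converges_iff] at h h'
  simp [t3] at h'
  funext i; fin_cases i <;> simp [t3] <;> omega

/-- If `a` and `t₄ a` both converge then `t₄ a = a` (`x₀ = x₄`). -/
theorem converges_t4_fixed (a : Fin 8 → ℤ) (h : Converges a) (h' : Converges (t4 a)) : t4 a = a := by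
  rw [converges_iff] at h h'
  simp [t4] at h'
  funext i; fin_cases i <;> simp [t4] <;> omega

/-- If `a` and `t₅ a` both converge then `t₅ a = a` (`x₀ = x₅`). -/
theorem converges_t5_fixed (a : Fin 8 → ℤ) (h : Converges a) (h' : Converges (t5 a)) : t5 a = a := by
  rw [converges_iff] at h h'
  simp [t5] at h'
  funext i; fin_cases i <;> simp [t5] <;> omega

/-- If `a` and `t₆ a` both converge then `t₆ a = a` (`x₀ = x₆`). -/
theorem converges_t6_fixed (a : Fin 8 → ℤ) (h : Converges a) (h' : Converges (t6 a)) : t6 a = a := by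
  rw [converges_iff] at h h'
  simp [t6] at h'
  funext i; fin_cases i <;> simp [t6] <;> omega

/-- If `a` and `t₇ a` both converge then `t₇ a = a` (`x₀ = x₇`). -/
theorem converges_t7_fixed (a : Fin 8 → ℤ) (h : Converges a) (h' : Converges (t7 a)) : t7 a = a := by
  rw [converges_iff] at h h'
  simp [t7] at h'
  funext i; fin_cases i <;> simp [t7] <;> omega

/-! ### The full `S₈`-action on the symmetric coordinates and the coset law -/

/-- Signed symmetric coordinates `x = (s₀, −s₁, …, −s₇)`; `S₈` acts on `x` by permuting coordinates. -/
def xOfS (s : Fin 8 → ℤ) : Fin 8 → ℤ := fun k => if k = 0 then s 0 else - s k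

/-- Inverse of `xOfS`. -/
def sOfX (x : Fin 8 → ℤ) : Fin 8 → ℤ := fun k => if k = 0 then x 0 else - x k

/-- `sOfX` is a left inverse of `xOfS`. -/
theorem sOfX_xOfS (s : Fin 8 → ℤ) : sOfX (xOfS s) = s := by
  funext k; by_cases hk : k = 0 <;> simp [sOfX, xOfS, hk]

/-- The action of `π ∈ S₈` on `s`: the coordinate `x_m` is moved to position `π m`. -/
def actS (π : Perm (Fin 8)) (s : Fin 8 → ℤ) : Fin 8 → ℤ := sOfX fun k => xOfS s (π.symm k)

/-- `t₁` is the transposition `(x₀ x₁)` in this action. -/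
theorem actS_swap01 (s : Fin 8 → ℤ) : actS (swap 0 1) s = ![-s 1, -s 0, s 2, s 3, s 4, s 5, s 6, s 7] := by
  funext k; fin_cases k <;> simp [actS, sOfX, xOfS, swap_apply_def]

/-- **Reduction.** If `x_{π⁻¹(0)} = x₀` then `π • s` is already an `S₇`-image of `s`
(`σ = π ∘ (0 π⁻¹0)` fixes `0`). -/
theorem exists_stabilizer_of_x0_eq (π : Perm (Fin 8)) (s : Fin 8 → ℤ)
    (h : xOfS s (π.symm 0) = xOfS s 0) :
    ∃ σ : Perm (Fin 8), σ 0 = 0 ∧ actS σ s = actS π s := by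
  refine ⟨π * swap 0 (π.symm 0), ?_, ?_⟩
  · simp [Perm.mul_apply]
  · have hfun : (fun k => xOfS s ((π * swap 0 (π.symm 0)).symm k)) = fun k => xOfS s (π.symm k) := by
      funext k
      have hk : (π * swap 0 (π.symm 0)).symm k = swap 0 (π.symm 0) (π.symm k) := rfl
      rw [hk, swap_apply_def]
      split_ifs with h1 h2
      · rw [h1]; exact h
      · rw [h2]; exact h.symm
      · rfl
    show sOfX _ = sOfX _
    rw [hfun]

/-- `xOfS` is a left inverse of `sOfX`. -/
theorem xOfS_sOfX (f : Fin 8 → ℤ) : xOfS (sOfX f) = f := by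
  funext k; by_cases hk : k = 0 <;> simp [sOfX, xOfS, hk]

/-- In `x`-coordinates `actS π` permutes the coordinates: `x(π • s)_k = x(s)_{π⁻¹ k}`. -/
theorem xOfS_actS (π : Perm (Fin 8)) (s : Fin 8 → ℤ) (k : Fin 8) :
    xOfS (actS π s) k = xOfS s (π.symm k) := by
  simp only [actS, xOfS_sOfX]

/-- **On the convergence cone `x₀` is the largest signed symmetric coordinate**: `Converges (aOf s)` gives
`x_k ≤ x₀` for every `k` (from the two forms `x₀+x₂, x₀+x₃ ∈ F` and the pair forms `−(x_j+x_k) ∈ F` with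
`j ∈ {2,3}`, which cover every `k`). -/
theorem x_le_x0_of_converges (s : Fin 8 → ℤ) (h : Converges (aOf s)) (k : Fin 8) : xOfS s k ≤ xOfS s 0 := by
  rw [converges_iff] at h
  simp [aOf] at h
  fin_cases k <;> simp [xOfS] <;> omega

/-- **The `S₈` coset law**: whenever `aOf s` and `aOf (π • s)` both converge, `x_{π⁻¹(0)} = x₀`. -/
def S8CosetLaw : Prop :=
  ∀ (π : Perm (Fin 8)) (s : Fin 8 → ℤ), Converges (aOf s) → Converges (aOf (actS π s)) →
    xOfS s (π.symm 0) = xOfS s 0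

/-- PROVED: a permutation keeps the cone only if it keeps the position of the maximal coordinate. -/
theorem s8CosetLaw : S8CosetLaw := by
  intro π s h h'
  refine le_antisymm (x_le_x0_of_converges s h (π.symm 0)) ?_
  have h2 := x_le_x0_of_converges (actS π s) h' (π 0)
  rw [xOfS_actS, xOfS_actS, Equiv.symm_apply_apply] at h2
  exact h2

/-- **Non-positive automorphisms add nothing** (answer, at integer points, to the question on p. 23 of
arXiv:2210.03391): if `s` and `π • s` both give convergent parameters then `π • s = σ • s` for some `σ ∈ S₇ = Stab(0)`,
so every relation / gauge / `p`-adic comparison a non-positive element could give is already an `S₇` one (BZ (29)). -/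
theorem nonpositive_adds_nothing (π : Perm (Fin 8)) (s : Fin 8 → ℤ)
    (h : Converges (aOf s)) (h' : Converges (aOf (actS π s))) :
    ∃ σ : Perm (Fin 8), σ 0 = 0 ∧ actS σ s = actS π s :=
  exists_stabilizer_of_x0_eq π s (s8CosetLaw π s h h')

end Summit.KontsevichZagierPeriods.Zeta5Search.RVGroup
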